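import Literature.Topology.PlanarFoliations.StarGate
import Literature.Topology.PlanarFoliations.ProngJunction
import Literature.Topology.FourManifolds.TautFoliationsPathFence
import Literature.Topology.FourManifolds.TautFoliationsFencePush
import HarnessLib

/-!
# The edge fence of a separatrix between two prong stars

Topic: Topology / PlanarFoliations, sequel to `StarGate.lean`, `ProngJunction.lean`; fences
(`TautFoliationsPathFence.lean`, `TautFoliationsPlaqueSlide.lean`, `TautFoliationsFenceTrans.lean`,
`TautFoliationsFencePush.lean`). Let `D` be star data, `a = pt j (β₀, 0)` a prong point of the
star at `v` and `a' = pt j' (β₀', 0)` a prong point of the star at `v'`, joined by a leafwise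
path `ℓ` of the planar foliation (an arc of the separatrix through them), with prong boxes `K`,
`K'`. Given a level conversion `χ` at `a` (`χ τ₀ = 0`), **there is a fence of the ambient
foliation `T` over the image of the arc, from the star vertical of `(j, β₀)` converted by `χ` to
the star vertical of `(j', β₀')` converted by a new level conversion `χ'`** (the holonomy of the
arc read in the local models), for a germ path from the junction germ `sectorGerm j 0 β₀ χ τ₀ 1`
to the junction germ `sectorGerm j' β₀' 0 χ' τ₀ 0` — so that it concatenates with the gate fences
of `StarGate.lean` at both ends — **whose horizontals are the images of planar leaf arcs**: at
level `τ` the horizontal runs in the image of the planar leaf through the point over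
`pt j (β₀, χ τ)` and ends at the point over `pt j' (β₀', χ' τ)` of that leaf
(`StarData.exists_edgeFence`); at the base level the planar horizontal is the concatenation of the
constant path at `K.base`, `ℓ`, and the constant path at `K'.base`. Construction: slide in the box of `K` from the star vertical to
the box vertical, planar fence over the arc (`exists_pathFence`), slide in the box of `K'` back to
the star vertical, concatenated in `X` and pushed to `M` along the foliated map `g ∘ ι`; the
junction germs are identified by `pushGerm_eq_germSection_of_prongBox`.

* `transFun` (**definition**): the level-free concatenation of two maps on `I` (so that
  `transFence Φ₁ Φ₂ θ τ = transFun (Φ₁ · τ) (Φ₂ · τ) θ` and `(γ.trans γ') θ = transFun γ γ' θ`),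
  used to describe base levels of concatenated fences pointwise.
* `StarData.pushGerm_eq_germSection_of_prongBox` (**proved**): the push-forward of a planar germ
  `germ (e⁻¹ ∘ h_c)` at a prong point, where `e` converts levels to `c`-heights along the star
  vertical, is the germ `germ ((Λ ∘ χ)⁻¹ ∘ h_{box v})` of the local model.
* `StarData.exists_edgeFence` (**proved**); `StarData.EdgeFence` (**structure**) packages its
  output and `StarData.edgeFence` (**definition**) chooses one, so that walk fences can be
  *defined* by recursion (`WalkFence.lean`).

## References

* C. Camacho, A. Lins Neto, *Geometric Theory of Foliations*, Birkhäuser (1985), Ch. IV §2,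
  Ch. VII §2 [CamachoLinsNeto1985].
-/

noncomputable section

open Set Filter Function Metric unitInterval
open _root_.Topology
open Literature.Topology.FourManifolds Literature.Topology.FourManifolds.Foliation

namespace Literature.Topology.PlanarFoliations

/-! ## Level-free concatenation -/

section TransFun

variable {Y : Type*}

/-- **The level-free concatenation** of two maps on the unit interval: `f` reparametrised on
`[0, 1/2]`, `f'` on `(1/2, 1]` (the pointwise shape of `transFence` and of `Path.trans`).
[folklore] -/
def transFun (f f' : I → Y) (θ : I) : Y :=
  if (θ : ℝ) ≤ 1 / 2 then f (fstHalf θ) else f' (sndHalf θ)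

/-- A concatenated fence at a level is the level-free concatenation of the pieces at that level.
[folklore] -/
theorem transFence_apply_eq_transFun (Φ₁ Φ₂ : I → ℝ → Y) (θ : I) (τ : ℝ) :
    transFence Φ₁ Φ₂ θ τ = transFun (fun θ ↦ Φ₁ θ τ) (fun θ ↦ Φ₂ θ τ) θ := by
  unfold transFence transFun
  split_ifs <;> rfl

/-- The level-free concatenation only depends on the values of the pieces. [folklore] -/
theorem transFun_congr {f f' g₁ g₂ : I → Y} (h : ∀ θ, f θ = g₁ θ) (h' : ∀ θ, f' θ = g₂ θ) (θ : I) :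
    transFun f f' θ = transFun g₁ g₂ θ := by
  unfold transFun
  split_ifs
  exacts [h _, h' _]

/-- Post-composition commutes with the level-free concatenation. [folklore] -/
theorem transFun_map {Y' : Type*} (φ : Y → Y') (f f' : I → Y) (θ : I) :
    transFun (fun θ ↦ φ (f θ)) (fun θ ↦ φ (f' θ)) θ = φ (transFun f f' θ) := by
  unfold transFun
  split_ifs <;> rfl

/-- At `θ = 0`. [folklore] -/
@[simp] theorem transFun_zero (f f' : I → Y) : transFun f f' 0 = f 0 := by
  unfold transFun
  rw [if_pos (show ((0 : I) : ℝ) ≤ 1 / 2 by norm_num), fstHalf_zero]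

/-- At `θ = 1`. [folklore] -/
@[simp] theorem transFun_one (f f' : I → Y) : transFun f f' 1 = f' 1 := by
  unfold transFun
  rw [if_neg (show ¬ ((1 : I) : ℝ) ≤ 1 / 2 by norm_num), sndHalf_one]

/-- The concatenation of paths is the level-free concatenation, pointwise. [folklore] -/
theorem _root_.Path.trans_apply_eq_transFun [TopologicalSpace Y] {a b c : Y} (γ : Path a b) (γ' : Path b c) (θ : I) :
    (γ.trans γ') θ = transFun γ γ' θ := by
  unfold transFun
  split_ifs with h
  · exact Path.trans_apply_of_le γ γ' h
  · exact Path.trans_apply_of_ge γ γ' (not_le.1 h).le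

/-- The level-free concatenation of continuous maps agreeing at the junction is continuous.
[folklore] -/
theorem continuous_transFun [TopologicalSpace Y] {f f' : I → Y} (hf : Continuous f) (hf' : Continuous f')
    (h : f 1 = f' 0) : Continuous (transFun f f') := by
  have hc : Continuous fun θ : I ↦ if (θ : ℝ) ≤ 1 / 2 then f (fstHalf θ) else f' (sndHalf θ) :=
    Continuous.if_le (hf.comp continuous_fstHalf) (hf'.comp continuous_sndHalf) continuous_subtype_val
      continuous_const fun θ hθ ↦ by rw [fstHalf_eq_one hθ, sndHalf_eq_zero hθ, h]
  exact hc

end TransFun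

/-- A sliding fence between two transversals which agree at a level is constant at that level.
[folklore] -/
theorem slideFence_apply_of_eq {B' : Type*} [NormedAddCommGroup B'] [NormedSpace ℝ B'] {M' : Type*} [TopologicalSpace M']
    {c : OpenPartialHomeomorph M' (B' × ℝ)} {ψ : ℝ → ℝ} {T₁ T₂ : ℝ → M'} {τ : ℝ} (h : T₁ τ = T₂ τ)
    (h₁ : T₁ τ ∈ plaque c (ψ τ)) (θ : I) : slideFence c ψ T₁ T₂ θ τ = T₁ τ := by
  rw [slideFence, slideB, ← h, ← add_smul, sub_add_cancel, one_smul, ← h₁.2, Prod.mk.eta]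
  exact c.left_inv h₁.1

variable {X : Type*} [TopologicalSpace X] [Nonempty X] {F : Foliation ℝ X} {ι : X → ℂ}
variable {B : Type*} [NormedAddCommGroup B] {M : Type*} [TopologicalSpace M]
  {T : Foliation B M} {g : ℂ → M}

namespace StarData

variable (D : StarData F ι T g) (hι : IsOpenEmbedding ι) {v : ℂ} (hv : D.nprong v ≠ 0)
  {j : ZMod (D.nprong v)} {β₀ : ℝ} (K : ProngBox (D.star v hv) hι j β₀)

/-! ## The junction germs -/

/-- **The push-forward of the planar junction germ is the junction germ of the local model.** Let
`e : ℝ ≃o ℝ` agree near `τ₀` with the `c`-height along the star vertical of `K` converted by `χ`,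
and `d` a planar germ at the base point of `K` equal to `germ (e⁻¹ ∘ h_c)`. Then the pushed germ is
`germ ((Λ ∘ χ)⁻¹ ∘ h_{box v})` at `g (pt j (β₀, 0))`. [folklore] -/
theorem pushGerm_eq_germSection_of_prongBox (χ : ℝ ≃o ℝ) {τ₀ : ℝ}
    (hχ₀ : χ τ₀ = 0) {η : ℝ} (hη : 0 < η)
    (hK : ∀ τ ∈ Ioo (τ₀ - η) (τ₀ + η), (β₀, χ τ) ∈ (D.star v hv).rect ∧
      (D.star v hv).pt j (β₀, χ τ) ∈ ball ((D.star v hv).pt j (β₀, 0)) K.r ∧ K.T₁ χ τ ∈ K.U)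
    (e : ℝ ≃o ℝ) (he : ∀ τ ∈ Ioo (τ₀ - η) (τ₀ + η), (K.c (K.T₁ χ τ)).2 = e τ)
    (d : F.GermSpace) (hdpt : ofLeafSpace d.pt = K.base) (hdgerm : d.germ = ↑(e.symm ∘ height K.c)) :
    D.foliated.pushGerm d = T.germSection (D.box_mem v (D.mem_P v hv)) (D.gateIso hv χ τ₀)
      (isHomeoGermAt_orderIso (D.gateIso hv χ).symm _) ((D.box v (g ((D.star v hv).pt j (β₀, 0)))).1) := by
  have hf := D.foliated
  have hbox := D.box_mem v (D.mem_P v hv)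
  have hτ₀ : τ₀ ∈ Ioo (τ₀ - η) (τ₀ + η) := ⟨by linarith, by linarith⟩
  have hrect0 : ((β₀, 0) : ℝ × ℝ) ∈ (D.star v hv).rect := by have := (hK τ₀ hτ₀).1; rwa [hχ₀] at this
  have hbaseS : ι K.base ∈ (D.star v hv).S j := by rw [K.ι_base]; exact (D.star v hv).pt_mem hrect0
  have hgsrc : g (ι K.base) ∈ (D.box v).source := D.mapsTo_S hv j hbaseS
  have hlev0 : D.level v ((D.star v hv).pt j (β₀, 0)) = D.gateIso hv χ τ₀ := by
    rw [gateIso_apply, hχ₀]; exact D.level_pt_eq_levelIso hv j hrect0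
  -- the two base points agree
  have hpt : ofLeafSpace (hf.pushGerm d).pt = ofLeafSpace (T.germSection hbox (D.gateIso hv χ τ₀)
      (isHomeoGermAt_orderIso (D.gateIso hv χ).symm _) ((D.box v (g ((D.star v hv).pt j (β₀, 0)))).1)).pt := by
    rw [hf.ofLeafSpace_pushGerm_pt, hdpt, germSection_pt, ofLeafSpace_leafPlaqueMap]
    show g (ι K.base) = (D.box v).symm ((D.box v (g ((D.star v hv).pt j (β₀, 0)))).1, D.gateIso hv χ τ₀)
    rw [K.ι_base, ← hlev0]
    show g ((D.star v hv).pt j (β₀, 0)) = (D.box v).symm ((D.box v (g ((D.star v hv).pt j (β₀, 0)))).1, (D.box v (g ((D.star v hv).pt j (β₀, 0)))).2)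
    rw [Prod.mk.eta, (D.box v).left_inv (by rw [← K.ι_base]; exact hgsrc)]
  -- the pushed germ is `germ ((Λ ∘ χ)⁻¹ ∘ h_{box v})`
  have hgerm : (hf.pushGerm d).germ = ↑((D.gateIso hv χ).symm ∘ height (D.box v)) := by
    refine hf.pushGerm_germ_eq_coe d ?_ ?_
    · rw [hdpt]
      exact T.isDistinguishedGerm_comp_height hbox hgsrc (isHomeoGermAt_orderIso _ _)
    · rw [hdgerm, Germ.coe_eq]
      -- near the base point: `e⁻¹ (h_c y) = (Λ ∘ χ)⁻¹ (level v (ι y))`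
      have he₀ : (K.c K.base).2 = e τ₀ := by rw [← he τ₀ hτ₀, K.T₁_base hχ₀]
      -- heights of `c` near the base point lie in `e '' (τ₀ - η, τ₀ + η)`
      have hnhds : ∀ᶠ y in 𝓝 K.base, y ∈ K.U ∧ (K.c y).2 ∈ Ioo (e (τ₀ - η)) (e (τ₀ + η)) := by
        have h1 : ∀ᶠ y in 𝓝 K.base, y ∈ K.U := K.U_mem
        have hc : ContinuousAt (fun y ↦ (K.c y).2) K.base := continuousAt_height K.base_mem_source
        exact h1.and (hc.preimage_mem_nhds (by
          rw [he₀]; exact Ioo_mem_nhds (e.strictMono (by linarith)) (e.strictMono (by linarith))))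
      rw [hdpt]
      filter_upwards [hnhds] with y ⟨hyU, hyh⟩
      simp only [comp_apply, height_apply]
      -- the level `τ` of `y`
      set τ := e.symm (K.c y).2 with hτ
      have hτI : τ ∈ Ioo (τ₀ - η) (τ₀ + η) := by
        constructor
        · have := e.symm.strictMono hyh.1; rwa [e.symm_apply_apply] at this
        · have := e.symm.strictMono hyh.2; rwa [e.symm_apply_apply] at this
      have hyτ : (K.c y).2 = (K.c (K.T₁ χ τ)).2 := by rw [he τ hτI, hτ, e.apply_symm_apply]
      have hH : (D.star v hv).H (ι y) = χ τ := by
        rw [K.H_eq_of_height_eq hyU (K.T₁_mem_U hK hτI) hyτ, K.H_T₁ hK hτI]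
      have hlev : (D.box v (g (ι y))).2 = D.gateIso hv χ τ := by
        show D.level v (ι y) = _
        rw [D.level_eq_levelIso hv (K.image_mem_S hyU), hH, gateIso_apply]
      rw [hlev, OrderIso.symm_apply_apply]
  exact GermSpace.ext_heq (by
    have := congrArg (toLeafSpace (F := T)) hpt
    simpa only [toLeafSpace_ofLeafSpace] using this) (by
    rw [hgerm, germSection_germ]
    exact GermSpace.coe_germ_heq hpt _)

omit [Nonempty X] in
/-- The junction germ of the local model, as a sector germ (end of a gate). [folklore] -/
theorem sectorGerm_one_eq (χ : ℝ ≃o ℝ) (τ₀ : ℝ) (βa : ℝ) :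
    D.sectorGerm hv j βa β₀ χ τ₀ 1 = T.germSection (D.box_mem v (D.mem_P v hv)) (D.gateIso hv χ τ₀)
      (isHomeoGermAt_orderIso (D.gateIso hv χ).symm _) ((D.box v (g ((D.star v hv).pt j (β₀, 0)))).1) := by
  unfold sectorGerm; rw [βline_one]

omit [Nonempty X] in
/-- The junction germ of the local model, as a sector germ (start of a gate). [folklore] -/
theorem sectorGerm_zero_eq (χ : ℝ ≃o ℝ) (τ₀ : ℝ) (βb : ℝ) :
    D.sectorGerm hv j β₀ βb χ τ₀ 0 = T.germSection (D.box_mem v (D.mem_P v hv)) (D.gateIso hv χ τ₀)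
      (isHomeoGermAt_orderIso (D.gateIso hv χ).symm _) ((D.box v (g ((D.star v hv).pt j (β₀, 0)))).1) := by
  unfold sectorGerm; rw [βline_zero]

/-! ## The edge fence -/

/-- **The edge fence of a separatrix arc between two prong points.** See the module docstring.
[cite: CamachoLinsNeto1985, Ch. VII §2] -/
theorem exists_edgeFence (ho : F.IsTransverselyOriented) (hβ₀ : β₀ ∈ Icc 0 (D.star v hv).ρ)
    {v' : ℂ} (hv' : D.nprong v' ≠ 0) {j' : ZMod (D.nprong v')} {β₀' : ℝ} (K' : ProngBox (D.star v' hv') hι j' β₀')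
    (hβ₀' : β₀' ∈ Icc 0 (D.star v' hv').ρ) (ℓ : Path K.base K'.base)
    (hℓ : Continuous (toLeafSpace ∘ ℓ : I → F.LeafSpace)) (χ : ℝ ≃o ℝ) {τ₀ : ℝ} (hχ₀ : χ τ₀ = 0) :
    ∃ (χ' : ℝ ≃o ℝ) (ε : ℝ) (Γ : Path (D.sectorGerm hv j 0 β₀ χ τ₀ 1) (D.sectorGerm hv' j' β₀' 0 χ' τ₀ 0))
      (Φ : I → ℝ → M) (Ψ : I → ℝ → X), χ' τ₀ = 0 ∧ 0 < ε ∧ IsFenceOn T Γ τ₀ ε Φ univ ∧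
      (∀ θ τ, Φ θ τ = g (ι (Ψ θ τ))) ∧
      (∀ τ ∈ Ioo (τ₀ - ε) (τ₀ + ε), Ψ 0 τ = K.T₁ χ τ) ∧ (∀ τ ∈ Ioo (τ₀ - ε) (τ₀ + ε), Ψ 1 τ = K'.T₁ χ' τ) ∧
      (∀ τ ∈ Ioo (τ₀ - ε) (τ₀ + ε), ι (K.T₁ χ τ) = (D.star v hv).pt j (β₀, χ τ)) ∧
      (∀ τ ∈ Ioo (τ₀ - ε) (τ₀ + ε), ι (K'.T₁ χ' τ) = (D.star v' hv').pt j' (β₀', χ' τ)) ∧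
      (∀ τ ∈ Ioo (τ₀ - ε) (τ₀ + ε), ∀ θ, Ψ θ τ ∈ F.leaf (K.T₁ χ τ)) ∧
      (∀ τ ∈ Ioo (τ₀ - ε) (τ₀ + ε), Continuous (toLeafSpace ∘ fun θ ↦ Ψ θ τ : I → F.LeafSpace)) ∧
      (∀ θ, Ψ θ τ₀ = transFun (transFun (fun _ ↦ K.base) ℓ) (fun _ ↦ K'.base) θ) ∧
      ContinuousOn (fun p : I × ℝ ↦ ι (Ψ p.1 p.2)) (univ ×ˢ Ioo (τ₀ - ε) (τ₀ + ε)) := by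
  have hf := D.foliated
  /- Step 0: radius for `K` and the height isomorphism `e` -/
  obtain ⟨ε₁, hε₁, hK⟩ := K.exists_radius hβ₀ χ hχ₀
  set e : ℝ ≃o ℝ := K.heightIso χ τ₀ ε₁ hε₁ hK with he_def
  have he : ∀ τ ∈ Icc (τ₀ - ε₁ / 2) (τ₀ + ε₁ / 2), e τ = (K.c (K.T₁ χ τ)).2 := fun τ hτ ↦ K.heightIso_apply hε₁ hK hτ
  have he₀ : e τ₀ = (K.c K.base).2 := K.heightIso_base hε₁ hK hχ₀
  have hI₂ : Ioo (τ₀ - ε₁ / 2) (τ₀ + ε₁ / 2) ⊆ Ioo (τ₀ - ε₁) (τ₀ + ε₁) := Ioo_subset_Ioo (by linarith) (by linarith)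
  /- Step 1: the slide-out in the box of `K` -/
  have hcK := K.c_mem
  have htargetK : ∀ w : ℝ × ℝ, w ∈ K.c.target := fun w ↦ by rw [F.target_eq K.c hcK]; exact mem_univ _
  set T₁ : ℝ → X := K.T₁ χ with hT₁
  set T₂ : ℝ → X := fun τ ↦ K.c.symm ((K.c K.base).1, e τ) with hT₂
  have hφ : IsHomeoGermAt e.symm (e τ₀) := isHomeoGermAt_orderIso e.symm _
  have hT₁pl : ∀ τ ∈ Ioo (τ₀ - ε₁ / 2) (τ₀ + ε₁ / 2), T₁ τ ∈ plaque K.c (e τ) := fun τ hτ ↦ K.T₁_mem_plaque hε₁ hK hτ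
  have hT₂pl : ∀ τ ∈ Ioo (τ₀ - ε₁ / 2) (τ₀ + ε₁ / 2), T₂ τ ∈ plaque K.c (e τ) := fun τ _ ↦
    ⟨K.c.map_target (htargetK _), by show (K.c (K.c.symm _)).2 = _; rw [K.c.right_inv (htargetK _)]⟩
  have hT₁c : ContinuousOn T₁ (Ioo (τ₀ - ε₁ / 2) (τ₀ + ε₁ / 2)) := (K.continuousOn_T₁ hK).mono hI₂
  have hT₂c : ContinuousOn T₂ (Ioo (τ₀ - ε₁ / 2) (τ₀ + ε₁ / 2)) :=
    ((F.continuous_symm_of_mem hcK).comp (continuous_const.prodMk e.continuous)).continuousOn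
  have hSO : IsFenceOn F (slidePath hcK hφ T₁ T₂) τ₀ (ε₁ / 2) (slideFence K.c e T₁ T₂) univ :=
    IsFenceOn.slide hcK hφ e.continuous.continuousOn e.injective.injOn (fun τ _ ↦ e.symm_apply_apply τ)
      (Eventually.of_forall fun r ↦ e.apply_symm_apply r) hT₁c hT₂c hT₁pl hT₂pl (by linarith)
  /- Step 2: the initial germ `d₀` of the planar fence -/
  set d₀ : F.GermSpace := slideGerm hcK hφ T₁ T₂ 1 with hd₀
  have hT₂τ₀ : T₂ τ₀ = K.base := by
    show K.c.symm ((K.c K.base).1, e τ₀) = K.base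
    rw [he₀, Prod.mk.eta, K.c.left_inv K.base_mem_source]
  have hd₀pt : ofLeafSpace d₀.pt = K.base := by
    rw [hd₀, ofLeafSpace_slideGerm_pt_one hcK hφ (hT₂pl τ₀ ⟨by linarith, by linarith⟩), hT₂τ₀]
  have hd₀lev : GermSpace.level d₀ = τ₀ := by
    rw [hd₀, slideGerm, GermSpace.level_germSection]; exact e.symm_apply_apply τ₀
  have hd₀incr : GermSpace.IsIncr d₀ :=
    GermSpace.isIncr_germSection hcK _ hφ (IsIncrHomeoGermAt.of_isHomeoGermAt hφ one_pos (e.symm.strictMono.strictMonoOn _)) _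
  have hd₀germ' : d₀.germ = ↑(e.symm ∘ height K.c) := slideGerm_germ hcK hφ T₁ T₂ 1
  /- Step 3: the planar fence over the arc -/
  have hx₀ : ofLeafSpace d₀.pt ∈ K.c.source := by rw [hd₀pt]; exact K.base_mem_source
  obtain ⟨εP, φ₀, ψ₀, φ₁, ψ₁, ΓP, ΦP, hεP, -, -, hψ₀c, -, hψ₀τ₀, hφψ₀, -, -, -, hψ₁c, hψ₁m, hψ₁τ₀, hφψ₁, -,
    hΓPlift, hΓP0, hd₀germ, hΓP1germ, hΦP, hΦP0, hΦP1⟩ :=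
    ho.exists_pathFence d₀ hd₀incr (ℓ.cast hd₀pt rfl) hℓ hcK hx₀ K'.c_mem K'.base_mem_source
  rw [hd₀lev] at hψ₀c hψ₀τ₀ hφψ₀ hψ₁c hψ₁m hψ₁τ₀ hφψ₁ hΦP hΦP0 hΦP1
  rw [hd₀pt] at hψ₀τ₀ hΦP0
  have hτ₀P : τ₀ ∈ Ioo (τ₀ - εP) (τ₀ + εP) := ⟨by linarith, by linarith⟩
  /- Step 4: the first junction: `ψ₀ = e` near `τ₀` -/
  have hψ₀e : ψ₀ =ᶠ[𝓝 τ₀] e := by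
    have hgerms : (↑(e.symm ∘ height K.c) : (𝓝 (ofLeafSpace d₀.pt)).Germ ℝ) = ↑(φ₀ ∘ height K.c) :=
      hd₀germ'.symm.trans hd₀germ
    have h₁ := F.eventuallyEq_of_comp_height_eq hcK hx₀ hgerms
    rw [hd₀pt, show (K.c K.base).2 = e τ₀ from he₀.symm] at h₁
    refine eventuallyEq_of_rightInverse_symm e h₁.symm (hψ₀c.continuousAt (Ioo_mem_nhds hτ₀P.1 hτ₀P.2))
      (by rw [hψ₀τ₀, he₀]) ?_
    exact Filter.eventually_of_mem (Ioo_mem_nhds hτ₀P.1 hτ₀P.2) hφψ₀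
  obtain ⟨ε₂, hε₂, hε₂sub⟩ := IsHomeoGermAt.exists_Ioo_subset_of_mem_nhds hψ₀e
  /- Step 5: the slide-in in the box of `K'` -/
  have hcK' := K'.c_mem
  have htargetK' : ∀ w : ℝ × ℝ, w ∈ K'.c.target := fun w ↦ by rw [F.target_eq K'.c hcK']; exact mem_univ _
  -- `ψ₁` extended to an order isomorphism `e₁`
  have hIccP : Icc (τ₀ - εP / 2) (τ₀ + εP / 2) ⊆ Ioo (τ₀ - εP) (τ₀ + εP) := Icc_subset_Ioo (by linarith) (by linarith)
  set e₁ : ℝ ≃o ℝ := orderIsoExtend ψ₁ (τ₀ - εP / 2) (τ₀ + εP / 2) (by linarith) (hψ₁c.mono hIccP) (hψ₁m.mono hIccP)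
    with he₁_def
  have he₁ : ∀ τ ∈ Icc (τ₀ - εP / 2) (τ₀ + εP / 2), e₁ τ = ψ₁ τ := fun τ hτ ↦ orderIsoExtend_apply_of_mem _ _ _ hτ
  have he₁τ₀ : e₁ τ₀ = (K'.c K'.base).2 := by rw [he₁ τ₀ ⟨by linarith, by linarith⟩, hψ₁τ₀]
  have he₁ev : ψ₁ =ᶠ[𝓝 τ₀] e₁ :=
    Filter.eventually_of_mem (Icc_mem_nhds (by linarith) (by linarith)) fun τ hτ ↦ (he₁ τ hτ).symm
  -- the height of `c'` along the star vertical of `K'`, as an order isomorphism `ν`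
  obtain ⟨η₁, hη₁, hK'₀⟩ := K'.exists_radius hβ₀' (OrderIso.refl ℝ) (τ₀ := 0) rfl
  set ν : ℝ ≃o ℝ := K'.heightIso (OrderIso.refl ℝ) 0 η₁ hη₁ hK'₀ with hν_def
  have hν : ∀ s ∈ Icc (0 - η₁ / 2) (0 + η₁ / 2), ν s = (K'.c (K'.T₁ (OrderIso.refl ℝ) s)).2 := fun s hs ↦
    K'.heightIso_apply hη₁ hK'₀ hs
  have hν₀ : ν 0 = (K'.c K'.base).2 := K'.heightIso_base hη₁ hK'₀ rfl
  -- the new level conversion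
  set χ' : ℝ ≃o ℝ := e₁.trans ν.symm with hχ'_def
  have hχ'apply : ∀ τ, χ' τ = ν.symm (e₁ τ) := fun τ ↦ rfl
  have hχ'₀ : χ' τ₀ = 0 := by rw [hχ'apply, he₁τ₀, ← hν₀, ν.symm_apply_apply]
  obtain ⟨ε₃, hε₃, hK'⟩ := K'.exists_radius hβ₀' χ' hχ'₀
  -- levels for which `χ' τ` is in the domain of `ν`
  have hχ'small : ∀ᶠ τ in 𝓝 τ₀, χ' τ ∈ Ioo (0 - η₁ / 2) (0 + η₁ / 2) := by
    have hc : ContinuousAt χ' τ₀ := χ'.continuous.continuousAt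
    exact hc.preimage_mem_nhds (by rw [hχ'₀]; exact Ioo_mem_nhds (by linarith) (by linarith))
  obtain ⟨ε₄, hε₄, hε₄sub⟩ := IsHomeoGermAt.exists_Ioo_subset_of_mem_nhds hχ'small
  -- the radius of the slide-in
  set ε₅ : ℝ := min ε₃ ε₄ with hε₅
  have hε₅pos : 0 < ε₅ := lt_min hε₃ hε₄
  have hI₅₃ : Ioo (τ₀ - ε₅) (τ₀ + ε₅) ⊆ Ioo (τ₀ - ε₃) (τ₀ + ε₃) :=
    Ioo_subset_Ioo (by rw [hε₅]; linarith [min_le_left ε₃ ε₄]) (by rw [hε₅]; linarith [min_le_left ε₃ ε₄])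
  have hI₅₄ : Ioo (τ₀ - ε₅) (τ₀ + ε₅) ⊆ Ioo (τ₀ - ε₄) (τ₀ + ε₄) :=
    Ioo_subset_Ioo (by rw [hε₅]; linarith [min_le_right ε₃ ε₄]) (by rw [hε₅]; linarith [min_le_right ε₃ ε₄])
  set T₁' : ℝ → X := fun τ ↦ K'.c.symm ((K'.c K'.base).1, e₁ τ) with hT₁'
  set T₂' : ℝ → X := K'.T₁ χ' with hT₂'
  have hφ' : IsHomeoGermAt e₁.symm (e₁ τ₀) := isHomeoGermAt_orderIso e₁.symm _
  have hheight₂' : ∀ τ ∈ Ioo (τ₀ - ε₅) (τ₀ + ε₅), (K'.c (T₂' τ)).2 = e₁ τ := by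
    intro τ hτ
    have hs := hε₄sub (hI₅₄ hτ)
    show (K'.c (K'.T₁ (OrderIso.refl ℝ) (χ' τ))).2 = e₁ τ
    rw [← hν _ (Ioo_subset_Icc_self hs), hχ'apply, ν.apply_symm_apply]
  have hT₁'pl : ∀ τ ∈ Ioo (τ₀ - ε₅) (τ₀ + ε₅), T₁' τ ∈ plaque K'.c (e₁ τ) := fun τ _ ↦
    ⟨K'.c.map_target (htargetK' _), by show (K'.c (K'.c.symm _)).2 = _; rw [K'.c.right_inv (htargetK' _)]⟩
  have hT₂'pl : ∀ τ ∈ Ioo (τ₀ - ε₅) (τ₀ + ε₅), T₂' τ ∈ plaque K'.c (e₁ τ) := fun τ hτ ↦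
    ⟨K'.T₁_mem_source hK' (hI₅₃ hτ), hheight₂' τ hτ⟩
  have hT₁'c : ContinuousOn T₁' (Ioo (τ₀ - ε₅) (τ₀ + ε₅)) :=
    ((F.continuous_symm_of_mem hcK').comp (continuous_const.prodMk e₁.continuous)).continuousOn
  have hT₂'c : ContinuousOn T₂' (Ioo (τ₀ - ε₅) (τ₀ + ε₅)) := (K'.continuousOn_T₁ hK').mono hI₅₃
  have hSI : IsFenceOn F (slidePath hcK' hφ' T₁' T₂') τ₀ ε₅ (slideFence K'.c e₁ T₁' T₂') univ :=
    IsFenceOn.slide hcK' hφ' e₁.continuous.continuousOn e₁.injective.injOn (fun τ _ ↦ e₁.symm_apply_apply τ)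
      (Eventually.of_forall fun r ↦ e₁.apply_symm_apply r) hT₁'c hT₂'c hT₁'pl hT₂'pl hε₅pos
  /- Step 6: the third junction: `ΓP 1` is the initial germ of the slide-in -/
  have hΓP1pt : ofLeafSpace (ΓP 1).pt = K'.base := by
    have := congr_fun hΓPlift 1
    simp only [comp_apply] at this
    rw [show ofLeafSpace (ΓP 1).pt = ofLeafSpace (GermSpace.proj (ΓP 1)) from rfl, this]
    show (ℓ.cast hd₀pt rfl) 1 = K'.base
    exact (ℓ.cast hd₀pt rfl).target
  have hT₁'τ₀ : T₁' τ₀ = K'.base := by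
    show K'.c.symm ((K'.c K'.base).1, e₁ τ₀) = K'.base
    rw [he₁τ₀, Prod.mk.eta, K'.c.left_inv K'.base_mem_source]
  have hφ₁e₁ : φ₁ =ᶠ[𝓝 (e₁ τ₀)] e₁.symm :=
    eventuallyEq_symm_of_leftInverse e₁ he₁ev (Filter.eventually_of_mem (Ioo_mem_nhds hτ₀P.1 hτ₀P.2) hφψ₁)
  have hΓP1 : ΓP 1 = slideGerm hcK' hφ' T₁' T₂' 0 := by
    have hpt : ofLeafSpace (ΓP 1).pt = ofLeafSpace (slideGerm hcK' hφ' T₁' T₂' 0).pt := by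
      rw [hΓP1pt, ofLeafSpace_slideGerm_pt_zero hcK' hφ' (hT₁'pl τ₀ ⟨by linarith, by linarith⟩), hT₁'τ₀]
    have hgerm : (ΓP 1).germ = ↑(e₁.symm ∘ height K'.c) := by
      rw [hΓP1germ, Germ.coe_eq]
      have hc : ContinuousAt (height K'.c) (ofLeafSpace (ΓP 1).pt) := by
        rw [hΓP1pt]; exact continuousAt_height K'.base_mem_source
      have hval : height K'.c (ofLeafSpace (ΓP 1).pt) = e₁ τ₀ := by rw [hΓP1pt, he₁τ₀]; rfl
      rw [← hval] at hφ₁e₁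
      exact (hc.tendsto.eventually hφ₁e₁).mono fun y hy ↦ by simp only [comp_apply]; exact hy
    exact GermSpace.ext_heq (by
      have := congrArg (toLeafSpace (F := F)) hpt
      simpa only [toLeafSpace_ofLeafSpace] using this) (by
      rw [hgerm, slideGerm_germ]
      exact GermSpace.coe_germ_heq hpt _)
  /- Step 7: concatenation of the three planar fences -/
  set εA : ℝ := min (min (ε₁ / 2) (εP / 2)) (min ε₂ ε₅) with hεA
  have hεApos : 0 < εA := lt_min (lt_min (by linarith) (by linarith)) (lt_min hε₂ hε₅pos)
  have hεA₁ : εA ≤ ε₁ / 2 := (min_le_left _ _).trans (min_le_left _ _)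
  have hεAP : εA ≤ εP / 2 := (min_le_left _ _).trans (min_le_right _ _)
  have hεA₂ : εA ≤ ε₂ := (min_le_right _ _).trans (min_le_left _ _)
  have hεA₅ : εA ≤ ε₅ := (min_le_right _ _).trans (min_le_right _ _)
  have hIA : ∀ {ε' : ℝ}, εA ≤ ε' → Ioo (τ₀ - εA) (τ₀ + εA) ⊆ Ioo (τ₀ - ε') (τ₀ + ε') := fun h ↦
    Ioo_subset_Ioo (by linarith) (by linarith)
  have hIAP : Ioo (τ₀ - εA) (τ₀ + εA) ⊆ Ioo (τ₀ - εP) (τ₀ + εP) := Ioo_subset_Ioo (by linarith) (by linarith)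
  -- the planar fence as a path from `d₀` to the initial germ of the slide-in
  let ΓPp : Path d₀ (slideGerm hcK' hφ' T₁' T₂' 0) :=
    { toContinuousMap := ΓP
      source' := hΓP0
      target' := hΓP1 }
  have hPF : IsFenceOn F ΓPp τ₀ εA ΦP univ := hΦP.mono Subset.rfl (hεAP.trans (by linarith))
  have hSO' : IsFenceOn F (slidePath hcK hφ T₁ T₂) τ₀ εA (slideFence K.c e T₁ T₂) univ := hSO.mono Subset.rfl hεA₁
  have hSI' : IsFenceOn F (slidePath hcK' hφ' T₁' T₂') τ₀ (εA / 2) (slideFence K'.c e₁ T₁' T₂') univ :=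
    hSI.mono Subset.rfl (by linarith)
  have hjoin₁ : ∀ τ ∈ Ioo (τ₀ - εA) (τ₀ + εA), slideFence K.c e T₁ T₂ 1 τ = ΦP 0 τ := by
    intro τ hτ
    rw [slideFence_one (hT₂pl τ (hIA hεA₁ hτ)), hΦP0 τ (hIAP hτ)]
    show K.c.symm ((K.c K.base).1, e τ) = K.c.symm ((K.c K.base).1, ψ₀ τ)
    rw [show ψ₀ τ = e τ from hε₂sub (hIA hεA₂ hτ)]
  have hAM := IsFenceOn.trans hSO' hPF hjoin₁ (half_pos hεApos) (by linarith)
  have hjoin₂ : ∀ τ ∈ Ioo (τ₀ - εA / 2) (τ₀ + εA / 2),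
      transFence (slideFence K.c e T₁ T₂) ΦP 1 τ = slideFence K'.c e₁ T₁' T₂' 0 τ := by
    intro τ hτ
    have hτA : τ ∈ Ioo (τ₀ - εA) (τ₀ + εA) := ⟨by linarith [hτ.1], by linarith [hτ.2]⟩
    rw [transFence_one, hΦP1 τ (hIAP hτA), slideFence_zero (hT₁'pl τ (hIA hεA₅ hτA))]
    show K'.c.symm ((K'.c K'.base).1, ψ₁ τ) = K'.c.symm ((K'.c K'.base).1, e₁ τ)
    rw [he₁ τ ⟨by linarith [hτA.1], by linarith [hτA.2]⟩]
  have hPl := IsFenceOn.trans hAM hSI' hjoin₂ (by linarith : 0 < εA / 4) (by linarith)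
  /- Step 8: push to `M` -/
  set Γpl : Path (slideGerm hcK hφ T₁ T₂ 0) (slideGerm hcK' hφ' T₁' T₂' 1) :=
    ((slidePath hcK hφ T₁ T₂).trans ΓPp).trans (slidePath hcK' hφ' T₁' T₂') with hΓpl
  set Φpl : I → ℝ → X := transFence (transFence (slideFence K.c e T₁ T₂) ΦP) (slideFence K'.c e₁ T₁' T₂') with hΦpl
  obtain ⟨δ, hδ, hδle, hT⟩ := hf.exists_isFenceOn_comp (Γpl : C(I, F.GermSpace)) (by linarith : 0 < εA / 4) hPl
  /- Step 9: the junction germs in `M` -/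
  have hτ₀₁ : τ₀ ∈ Ioo (τ₀ - ε₁ / 2) (τ₀ + ε₁ / 2) := ⟨by linarith, by linarith⟩
  have hτ₀₅ : τ₀ ∈ Ioo (τ₀ - ε₅) (τ₀ + ε₅) := ⟨by linarith, by linarith⟩
  have hJ1 : hf.pushGerm (slideGerm hcK hφ T₁ T₂ 0) = D.sectorGerm hv j 0 β₀ χ τ₀ 1 := by
    rw [D.sectorGerm_one_eq hv]
    refine D.pushGerm_eq_germSection_of_prongBox hι hv K χ hχ₀ (half_pos hε₁) (fun τ hτ ↦ hK τ (hI₂ hτ)) e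
      (fun τ hτ ↦ (he τ (Ioo_subset_Icc_self hτ)).symm) _ ?_ (slideGerm_germ hcK hφ T₁ T₂ 0)
    rw [ofLeafSpace_slideGerm_pt_zero hcK hφ (hT₁pl τ₀ hτ₀₁)]
    exact K.T₁_base hχ₀
  have hJ4 : hf.pushGerm (slideGerm hcK' hφ' T₁' T₂' 1) = D.sectorGerm hv' j' β₀' 0 χ' τ₀ 0 := by
    rw [D.sectorGerm_zero_eq hv']
    refine D.pushGerm_eq_germSection_of_prongBox hι hv' K' χ' hχ'₀ hε₅pos (fun τ hτ ↦ hK' τ (hI₅₃ hτ)) e₁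
      (fun τ hτ ↦ hheight₂' τ hτ) _ ?_ (slideGerm_germ hcK' hφ' T₁' T₂' 1)
    rw [ofLeafSpace_slideGerm_pt_one hcK' hφ' (hT₂'pl τ₀ hτ₀₅)]
    exact K'.T₁_base hχ'₀
  let Γ : Path (D.sectorGerm hv j 0 β₀ χ τ₀ 1) (D.sectorGerm hv' j' β₀' 0 χ' τ₀ 0) :=
    { toFun := hf.pushGerm ∘ Γpl
      continuous_toFun := hf.continuous_pushGerm.comp Γpl.continuous
      source' := by show hf.pushGerm (Γpl 0) = _; rw [Γpl.source]; exact hJ1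
      target' := by show hf.pushGerm (Γpl 1) = _; rw [Γpl.target]; exact hJ4 }
  have hTΓ : IsFenceOn T Γ τ₀ δ (fun θ τ ↦ (g ∘ ι) (Φpl θ τ)) univ := hT
  /- Step 10: the conclusions -/
  have hδA : Ioo (τ₀ - δ) (τ₀ + δ) ⊆ Ioo (τ₀ - εA) (τ₀ + εA) := Ioo_subset_Ioo (by linarith) (by linarith)
  refine ⟨χ', δ, Γ, fun θ τ ↦ g (ι (Φpl θ τ)), Φpl, hχ'₀, hδ, hTΓ, fun θ τ ↦ rfl, fun τ hτ ↦ ?_, fun τ hτ ↦ ?_,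
    fun τ hτ ↦ K.ι_T₁ hK (hI₂ (hIA hεA₁ (hδA hτ))), fun τ hτ ↦ K'.ι_T₁ hK' (hI₅₃ (hIA hεA₅ (hδA hτ))),
    fun τ hτ θ ↦ ?_, fun τ hτ ↦ hPl.continuous_toLeafSpace ⟨by linarith [hτ.1], by linarith [hτ.2]⟩, fun θ ↦ ?_,
    hι.continuous.comp_continuousOn (hPl.cont.mono (prod_mono Subset.rfl (Ioo_subset_Ioo (by linarith) (by linarith))))⟩
  · -- `Ψ 0 τ = T₁ τ`
    show transFence (transFence (slideFence K.c e T₁ T₂) ΦP) (slideFence K'.c e₁ T₁' T₂') 0 τ = K.T₁ χ τ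
    rw [transFence_zero, transFence_zero, slideFence_zero (hT₁pl τ (hIA hεA₁ (hδA hτ)))]
  · -- `Ψ 1 τ = T₂' τ`
    show transFence (transFence (slideFence K.c e T₁ T₂) ΦP) (slideFence K'.c e₁ T₁' T₂') 1 τ = K'.T₁ χ' τ
    rw [transFence_one, slideFence_one (hT₂'pl τ (hIA hεA₅ (hδA hτ)))]
  · -- the horizontal runs in the leaf of `T₁ τ`
    have hτ' : τ ∈ Ioo (τ₀ - εA / 4) (τ₀ + εA / 4) := ⟨by linarith [hτ.1], by linarith [hτ.2]⟩
    have h := hPl.mem_leaf hτ' 0 θ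
    have h0 : Φpl 0 τ = K.T₁ χ τ := by
      show transFence (transFence (slideFence K.c e T₁ T₂) ΦP) (slideFence K'.c e₁ T₁' T₂') 0 τ = K.T₁ χ τ
      rw [transFence_zero, transFence_zero, slideFence_zero (hT₁pl τ (hIA hεA₁ (hδA hτ)))]
    rwa [h0] at h
  · -- the base level: the slides are constant, the planar fence is over `ℓ`
    show transFence (transFence (slideFence K.c e T₁ T₂) ΦP) (slideFence K'.c e₁ T₁' T₂') θ τ₀ = _
    simp only [transFence_apply_eq_transFun]
    refine transFun_congr (fun θ' ↦ transFun_congr (fun θ'' ↦ ?_) (fun θ'' ↦ ?_) θ') (fun θ' ↦ ?_) θ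
    · show slideFence K.c e T₁ T₂ θ'' τ₀ = K.base
      have h₁₂ : T₁ τ₀ = T₂ τ₀ := by rw [hT₂τ₀]; exact K.T₁_base hχ₀
      rw [slideFence_apply_of_eq h₁₂ (hT₁pl τ₀ hτ₀₁)]
      exact K.T₁_base hχ₀
    · show ΦP θ'' τ₀ = ℓ θ''
      rw [hΦP.base θ'' (mem_univ _)]
      have h := congr_fun hΓPlift θ''
      simp only [comp_apply] at h
      rw [show (ΓP θ'').pt = GermSpace.proj (ΓP θ'') from rfl, h]
      rfl
    · show slideFence K'.c e₁ T₁' T₂' θ' τ₀ = K'.base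
      have h₁₂ : T₁' τ₀ = T₂' τ₀ := by rw [hT₁'τ₀]; exact (K'.T₁_base hχ'₀).symm
      rw [slideFence_apply_of_eq h₁₂ (hT₁'pl τ₀ hτ₀₅), hT₁'τ₀]

/-! ## The edge fence as a chosen object -/

/-- **An edge fence** over the arc `ℓ` from the prong box `K` to the prong box `K'`, with input
level conversion `χ` at the level `τ₀`: the data and properties produced by `exists_edgeFence`.
[folklore] -/
structure EdgeFence {v' : ℂ} (hv' : D.nprong v' ≠ 0) {j' : ZMod (D.nprong v')} {β₀' : ℝ}
    (K' : ProngBox (D.star v' hv') hι j' β₀') (ℓ : Path K.base K'.base) (χ : ℝ ≃o ℝ) (τ₀ : ℝ) where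
  /-- the output level conversion -/
  χ' : ℝ ≃o ℝ
  /-- the level radius -/
  ε : ℝ
  /-- the germ path -/
  Γ : Path (D.sectorGerm hv j 0 β₀ χ τ₀ 1) (D.sectorGerm hv' j' β₀' 0 χ' τ₀ 0)
  /-- the fence -/
  Φ : I → ℝ → M
  /-- the planar description -/
  Ψ : I → ℝ → X
  χ'_apply : χ' τ₀ = 0
  ε_pos : 0 < ε
  isFenceOn : IsFenceOn T Γ τ₀ ε Φ univ
  Φ_eq : ∀ θ τ, Φ θ τ = g (ι (Ψ θ τ))
  Ψ_zero : ∀ τ ∈ Ioo (τ₀ - ε) (τ₀ + ε), Ψ 0 τ = K.T₁ χ τ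
  Ψ_one : ∀ τ ∈ Ioo (τ₀ - ε) (τ₀ + ε), Ψ 1 τ = K'.T₁ χ' τ
  ι_T₁ : ∀ τ ∈ Ioo (τ₀ - ε) (τ₀ + ε), ι (K.T₁ χ τ) = (D.star v hv).pt j (β₀, χ τ)
  ι_T₁' : ∀ τ ∈ Ioo (τ₀ - ε) (τ₀ + ε), ι (K'.T₁ χ' τ) = (D.star v' hv').pt j' (β₀', χ' τ)
  mem_leaf : ∀ τ ∈ Ioo (τ₀ - ε) (τ₀ + ε), ∀ θ, Ψ θ τ ∈ F.leaf (K.T₁ χ τ)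
  continuous_toLeafSpace : ∀ τ ∈ Ioo (τ₀ - ε) (τ₀ + ε), Continuous (toLeafSpace ∘ fun θ ↦ Ψ θ τ : I → F.LeafSpace)
  Ψ_base : ∀ θ, Ψ θ τ₀ = transFun (transFun (fun _ ↦ K.base) ℓ) (fun _ ↦ K'.base) θ
  continuousOn_ιΨ : ContinuousOn (fun p : I × ℝ ↦ ι (Ψ p.1 p.2)) (univ ×ˢ Ioo (τ₀ - ε) (τ₀ + ε))

/-- Edge fences exist. [cite: CamachoLinsNeto1985, Ch. VII §2] -/
theorem nonempty_edgeFence (ho : F.IsTransverselyOriented) (hβ₀ : β₀ ∈ Icc 0 (D.star v hv).ρ)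
    {v' : ℂ} (hv' : D.nprong v' ≠ 0) {j' : ZMod (D.nprong v')} {β₀' : ℝ} (K' : ProngBox (D.star v' hv') hι j' β₀')
    (hβ₀' : β₀' ∈ Icc 0 (D.star v' hv').ρ) (ℓ : Path K.base K'.base)
    (hℓ : Continuous (toLeafSpace ∘ ℓ : I → F.LeafSpace)) (χ : ℝ ≃o ℝ) {τ₀ : ℝ} (hχ₀ : χ τ₀ = 0) :
    Nonempty (D.EdgeFence hι hv K hv' K' ℓ χ τ₀) := by
  obtain ⟨χ', ε, Γ, Φ, Ψ, h₁, h₂, h₃, h₄, h₅, h₆, h₇, h₈, h₉, h₁₀, h₁₁, h₁₂⟩ :=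
    D.exists_edgeFence hι hv K ho hβ₀ hv' K' hβ₀' ℓ hℓ χ hχ₀
  exact ⟨⟨χ', ε, Γ, Φ, Ψ, h₁, h₂, h₃, h₄, h₅, h₆, h₇, h₈, h₉, h₁₀, h₁₁, h₁₂⟩⟩

/-- **The chosen edge fence.** [folklore] -/
def edgeFence (ho : F.IsTransverselyOriented) (hβ₀ : β₀ ∈ Icc 0 (D.star v hv).ρ)
    {v' : ℂ} (hv' : D.nprong v' ≠ 0) {j' : ZMod (D.nprong v')} {β₀' : ℝ} (K' : ProngBox (D.star v' hv') hι j' β₀')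
    (hβ₀' : β₀' ∈ Icc 0 (D.star v' hv').ρ) (ℓ : Path K.base K'.base)
    (hℓ : Continuous (toLeafSpace ∘ ℓ : I → F.LeafSpace)) (χ : ℝ ≃o ℝ) {τ₀ : ℝ} (hχ₀ : χ τ₀ = 0) :
    D.EdgeFence hι hv K hv' K' ℓ χ τ₀ :=
  Classical.choice (D.nonempty_edgeFence hι hv K ho hβ₀ hv' K' hβ₀' ℓ hℓ χ hχ₀)

end StarData

end Literature.Topology.PlanarFoliations
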